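import Literature.NumberTheory.LFunctions.Zhang2022.RepairBedLadderCertificatesDeep
import HarnessLib

/-!
# Zhang (2022) rescue bed (D-0124 (3)): stride-8 sweep certificates toward the ladder rung `D_61^− = −20950603`, file a
# of 5 (chunks 300518, 455072, 609626)

Topic `Literature/NumberTheory/LFunctions/Zhang2022` (Landau–Siegel audit tree; verdict-neutral), cell landau-siegel, LS RESCUE PROTOCOL
(D-0124) part (3) GENUINE BED, typer seat ls-rescue-typ-1. **Nothing here is a claim about Landau–Siegel zeros; the programme SEARCHES
and TYPES; no claim about Landau–Siegel zeros, Theorems 1–2 of arXiv:2211.02515 or a repaired Margin232 until a kernel theorem says so.**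
Pure CERTIFICATE file (theorems only): pieces of the minimality sweep for the rule-`L1y` rung `D_61^−` of bed-1's spec `bed1-KG1-v0.1`
(Lehmer–Lehmer–Shanks 1970): `sweep8 (allInertCheckNeg 61) (8m₀ + 3) n = true` says that no `N = 8m + 3`, `m₀ ≤ m < m₀ + n`, has all
primes `≤ 61` inert for `D = −N` (`RepairBedLadderCertificatesDeep.sweep8_sound`, `allInertCheck_neg_false_of_sweep8`; the other residues
mod `8` fail at the prime `2`). The whole range `2404147 ≤ N < 20950603` takes 15 such chunks of ≈ one minute of kernel time
(three per file); the assembly into `sweep61_neg` and **`isLeastAllInert_neg20950603`** is `RepairBedLadderCertificatesDeepNeg.lean`.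

## References

* [LehmerLehmerShanks1970] D. H. Lehmer, E. Lehmer, D. Shanks, *Integer sequences having prescribed quadratic character*,
  Math. Comp. 24 (1970) 433–451, §1 and Tables.
-/

namespace Literature.NumberTheory.LFunctions.Zhang2022.Repair.Bed

/-- Stride-8 certificate chunk at `y = 61`: every `N ≡ 3 (mod 8)` with `2404147 ≤ N ≤ 3640571` fails the all-inert check
(`154554` evaluations, one kernel declaration). [cite: LehmerLehmerShanks1970, §1] -/
theorem sweep61_neg_cert_300518 : sweep8 (allInertCheckNeg 61) (8 * 300518 + 3) 154554 = true := by
  decide +kernel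

/-- Stride-8 certificate chunk at `y = 61`: every `N ≡ 3 (mod 8)` with `3640579 ≤ N ≤ 4877003` fails the all-inert check
(`154554` evaluations, one kernel declaration). [cite: LehmerLehmerShanks1970, §1] -/
theorem sweep61_neg_cert_455072 : sweep8 (allInertCheckNeg 61) (8 * 455072 + 3) 154554 = true := by
  decide +kernel

/-- Stride-8 certificate chunk at `y = 61`: every `N ≡ 3 (mod 8)` with `4877011 ≤ N ≤ 6113435` fails the all-inert check
(`154554` evaluations, one kernel declaration). [cite: LehmerLehmerShanks1970, §1] -/
theorem sweep61_neg_cert_609626 : sweep8 (allInertCheckNeg 61) (8 * 609626 + 3) 154554 = true := by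
  decide +kernel

end Literature.NumberTheory.LFunctions.Zhang2022.Repair.Bed
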